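import Summits.BirchSwinnertonDyer.Rank1Residual.X11b.KolyvaginHeckeOrbitAdapter
import Summits.BirchSwinnertonDyer.Rank1Residual.X11b.KolyvaginTowerLiftConcrete
import Literature.NumberTheory.EllipticCurves.EichlerIntegralHeckeProofs
import Literature.NumberTheory.EllipticCurves.HeegnerPointsKolyvaginPrimaryEulerProofs
import Literature.NumberTheory.EllipticCurves.LFunctionPrimeCoeff
import HarnessLib

/-!
# Gross's trace relation `Tr_{K[ℓm]/K[m]} y(ℓm) = a_ℓ · y(m)` (Prop. 3.7 (1)) for the tree's
# concrete Kolyvagin–Heegner data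

Team x11b3 (N8/O2), `h44` programme, `h37` piece **(β2) — the ASSEMBLY** (deal R10-1 (c)(4),
R10-2 (1), R10-4; x11b3-p2 GEN 6).  Gross 1991, Prop. 3.7 (1): for `n = ℓm` with `ℓ` inert in `K`,
`ℓ ∤ mN`, the Heegner points `y_n = φ(x_n) ∈ E(K_n)` satisfy `Tr_ℓ y_n := Σ_{g ∈ G_ℓ} g y_n = a_ℓ y_m`
in `E(K_n)`, `G_ℓ = Gal(K_n/K_m)` (cyclic of order `ℓ + 1`).  Proof (chunk 217 L24 – 218 L1): the
`ℓ + 1` conjugates `g x_n` are exactly the points of the Hecke divisor `T_ℓ(x_m)`, and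
`φ(T_ℓ x_m) = a_ℓ φ(x_m)` (Eichler–Shimura / Knapp Thm. 11.74 (b)).

In the tree's currency:
* the `G_ℓ`-ADAPTER `exists_heckeOrbitIndex_bijective` (x11b3-p8, `KolyvaginHeckeOrbitAdapter`):
  automorphisms `σ_g` of `ℂ` extending each `g ∈ G_ℓ = ringClassGalOver ι (ℓm) m` and a BIJECTION
  `i : G_ℓ → Option (Fin ℓ)` with `LevelTransport N σ_g x(ℓm) (std (i g))`,
  `std (some j) = tpB ℓ j • x(m)`, `std none = tpD ℓ • x(m)`;
* `map_subtype_pointGalHom_eq` / `map_φ_of_levelTransport` (same file): `(g • y)_ℂ = σ_g ⋆ φ(x(ℓm))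
  = φ(std (i g))` — the modular parametrisation is `Aut(ℂ)`-equivariant at CM points (the tree's
  THEOREM `ModularParametrizationData.isAutEquivariantOnHeegner`, axioms standard);
* the Hecke sum `a_ℓ • φ(τ) = Σ_{j : Fin ℓ} φ(tpB ℓ j • τ) + φ(tpD ℓ • τ)` for `ℓ ∤ N`
  (`ModularParametrizationData.lFunction_zsmul_φ_of_not_dvd`, x11b3-p9's piece 1 currency);
* `#G_ℓ = ℓ + 1` ⇒ `orderOf σ_ℓ = ℓ + 1` (CYC-C `orderOf_eq_succ_of_zpowers_eq_ringClassGalOver`).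

END THEOREMS (the two shapes are x11b3-p8 GEN 7's, INBOX l.5346, adopted per R10-2 (1)):
* `map_sum_pointGalHom_eq_lFunction_smul` — **E(ℂ) form**: `(Σ_{g ∈ G} g • y)_ℂ = a_ℓ • φ(x(m))`
  for any finset `G` enumerating `G_ℓ` and any `y ∈ E(K[ℓm])` over `φ(x(ℓm))`;
  `map_sum_pointGalHom_eq_lFunction_smul_of_eq` — the same at a level `n = ℓ * m`;
* `sum_pow_pointGalHom_y_eq_lFunction_smul_map` — **`KolyvaginHeegnerData` form** at a level `n`
  with `ℓ ∥ n`: `Σ_{i < ℓ+1} (d.σ ℓ)^i • d.y = a_ℓ • (d'.y)↑` in `E(K[n])`, `d'` the data at level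
  `n/ℓ`, `↑` = base change along lit2's `RingClassField.inclusion` (`K[n/ℓ] ⊆ K[n]`);
* the `h37`-binder spellings (`KolyvaginRingClassInertia.h44_of_prop37_of_totallyRamified`,
  conjunct `grAct (A₀ m) (traceElt (σ m ℓ) ℓ) (y m) = W.frobeniusTrace ℓ • y'`):
  `grAct_traceElt_eq_smul_of_pointGalHom` (transfer to an abstract commutative `𝒢` acting through an
  injective equivariant `j : A →+ E(K[n])`, by `grAct_traceElt`) and
  `frobeniusTrace_smul_eq_of_lFunction_smul_eq` (`a_ℓ = W.LFunction ℓ = W.frobeniusTrace ℓ` at a good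
  prime of a global minimal model, `LFunction_apply_prime_eq_frobeniusTrace`).

Hypotheses = lit2 FILE C's END hypotheses (`HeegnerPointsHeckeOrbit`): `hND`, `hβ`, `ℓ` prime and
inert, `ℓ ∤ N`, `ℓ ∤ m`, `m ≠ 0`, `Nat.Coprime N m`, `hunits : 2 ≤ m ∨ d_K < -4` (carried as a
binder).  NO (β2-c) binder: `isAutEquivariantOnHeegner` and `φ_gamma0_smul_holds'` are tree theorems
with standard axioms (checked on the farm, memo `H37-ASSEMBLY-SCOPING.md` §0a).

HONEST FRAMING (H47): theorems only, 0 `def`s / 0 facts; this is PLUMBING toward Prop. 3.7 (1) for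
the tree's concrete data — it discharges neither `h37` (whose other conjuncts, notably (γ) = Prop.
3.7 (2), the congruence `y_n ≡ Frob y_{n/ℓ}`, keep the cited-fact currency, OPTION K) nor `h44`;
labelled set {`h37`}; nothing here is `p = 3`-specific (Gross's prime is `ℓ`; no `p` occurs); the
class record, (t), `Three.HsiehDescentAt₃` are untouched; nothing booked.

References: B. H. Gross, *Kolyvagin's work on modular elliptic curves*, LMS Lecture Notes 153 (1991),
§3 Prop. 3.7 (1) and its proof; H. Darmon, *Rational points on modular elliptic curves*, CBMS 101
(2004), Thm. 3.6, Prop. 3.10; A. W. Knapp, *Elliptic curves* (1993), Thm. 11.74 (b);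
G. Shimura, *Introduction to the arithmetic theory of automorphic functions* (1971), Thm. 7.14.
-/

noncomputable section

open scoped Classical MatrixGroups
open Complex UpperHalfPlane CongruenceSubgroup NumberField Module
open Literature.NumberTheory.EllipticCurves Literature.NumberTheory.EllipticCurves.RingClassField
open Literature.NumberTheory.EllipticCurves.ModularForms Literature.NumberTheory.EllipticCurves.KolyvaginEuler
open Literature.NumberTheory.QuadraticFields Literature.NumberTheory.QuadraticFields.RingClass
open Summit.BirchSwinnertonDyer.Rank1Residual.X11b.RingClassTower

namespace Summit.BirchSwinnertonDyer.Rank1Residual.X11b.HeegnerTrace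

variable {K : Type} [Field K] [NumberField K]

/-! ## §1 The trace relation in `E(ℂ)` -/

/-- **Gross's Prop. 3.7 (1) in `E(ℂ)`**: for `K` imaginary quadratic, `ℓ` an inert prime with
`ℓ ∤ N`, `ℓ ∤ m` (`m ≥ 1` prime to `N`, `β² ≡ d_K (4N)`), any finset `G` enumerating
`G_ℓ = Gal(K[ℓm]/K[m])` and any `y ∈ E(K[ℓm])` lying over `y(ℓm) = φ(x(ℓm))`,
`(Σ_{g ∈ G} g • y)_ℂ = a_ℓ • y(m)` with `a_ℓ = W.LFunction ℓ`.  Proof: each `(g • y)_ℂ` is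
`σ_g ⋆ φ(x(ℓm)) = φ(std (i g))` (`map_subtype_pointGalHom_eq`, `map_φ_of_levelTransport`) for the
bijection `i : G_ℓ → Option (Fin ℓ)` of `exists_heckeOrbitIndex_bijective`; reindex and apply the
Hecke sum `lFunction_zsmul_φ_of_not_dvd`.  Statement shape: x11b3-p8 GEN 7.
[cite: GrossLMS1991, §3 Prop. 3.7 (1) (proof, chunk 217 L24 – 218 L1)]
[cite: Knapp1993, Thm. 11.74 (b)] -/
theorem map_sum_pointGalHom_eq_lFunction_smul (hK : IsImaginaryQuadratic K) (ι : K →+* ℂ)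
    {N : ℕ} [NeZero N] {W : WeierstrassCurve ℚ} (Dt : ModularParametrizationData W N)
    (hND : IsCoprime (N : ℤ) (NumberField.discr K)) {β : ℤ}
    (hβ : (4 * N : ℤ) ∣ β ^ 2 - NumberField.discr K) {ℓ m : ℕ} (hℓ : ℓ.Prime)
    (hinert : (Ideal.span {(ℓ : 𝓞 K)}).IsPrime) (hℓN : ¬ ℓ ∣ N) (hℓm : ¬ ℓ ∣ m) (hm : m ≠ 0)
    (hNm : Nat.Coprime N m) (hunits : 2 ≤ m ∨ NumberField.discr K < -4)
    {G : Finset (ringClassField K ι (ℓ * m) ≃ₐ[ℚ] ringClassField K ι (ℓ * m))}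
    (hG : ∀ g, g ∈ G ↔ g ∈ ringClassGalOver ι (ℓ * m) m)
    {y : (W.baseChange (ringClassField K ι (ℓ * m))).toAffine.Point}
    (hy : WeierstrassCurve.Affine.Point.map (W' := W)
        (ringClassField K ι (ℓ * m)).subtype.toRatAlgHom y =
      heegnerPointComplexOfConductor Dt (NumberField.discr K) β (ℓ * m)) :
    WeierstrassCurve.Affine.Point.map (W' := W) (ringClassField K ι (ℓ * m)).subtype.toRatAlgHom
        (∑ g ∈ G, pointGalHom W (ringClassField K ι (ℓ * m)) g y) =
      W.LFunction ℓ • heegnerPointComplexOfConductor Dt (NumberField.discr K) β m := by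
  haveI : NeZero ℓ := ⟨hℓ.ne_zero⟩
  obtain ⟨σ, i, hi, hσ⟩ :=
    exists_heckeOrbitIndex_bijective hK ι hND hβ hℓ hinert hℓN hℓm hm hNm hunits
  -- the `ℓ + 1` points of `T_ℓ(x(m))`, indexed by `Option (Fin ℓ)`
  let F : Option (Fin ℓ) → (W.baseChange ℂ).toAffine.Point := fun o =>
    Dt.φ (o.elim (tpD ℓ • heegnerPointOfConductor (NumberField.discr K) β m)
      (fun j => tpB ℓ ((j : ℕ) : ℤ) • heegnerPointOfConductor (NumberField.discr K) β m))
  -- each conjugate `(g • y)_ℂ` is the `φ`-image of the indexed point of `T_ℓ(x(m))`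
  have hterm : ∀ g (hg : g ∈ G),
      WeierstrassCurve.Affine.Point.map (W' := W) (ringClassField K ι (ℓ * m)).subtype.toRatAlgHom
          (pointGalHom W (ringClassField K ι (ℓ * m)) g y) = F (i ⟨g, (hG g).1 hg⟩) := by
    intro g hg
    obtain ⟨-, hext, hT⟩ := hσ ⟨g, (hG g).1 hg⟩
    rw [map_subtype_pointGalHom_eq ι g hext y, hy, heegnerPointComplexOfConductor]
    exact map_φ_of_levelTransport Dt hT
  rw [map_sum, Finset.sum_bij (t := Finset.univ) (g := F) (fun g hg => i ⟨g, (hG g).1 hg⟩)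
    (fun _ _ => Finset.mem_univ _)
    (fun a₁ ha₁ a₂ ha₂ h => congrArg Subtype.val (hi.1 h))
    (fun b _ => by
      obtain ⟨⟨a, ha⟩, rfl⟩ := hi.2 b
      exact ⟨a, (hG a).2 ha, rfl⟩)
    hterm, Fintype.sum_option, heegnerPointComplexOfConductor,
    Dt.lFunction_zsmul_φ_of_not_dvd ℓ hℓ hℓN, add_comm]
  rfl

/-- The same at a level written `n = ℓ * m` (so that it applies to `K[n]` for `ℓ ∥ n`,
`m = n / ℓ`, without transporting along `ℓ * (n / ℓ) = n`).
[cite: GrossLMS1991, §3 Prop. 3.7 (1)] -/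
theorem map_sum_pointGalHom_eq_lFunction_smul_of_eq (hK : IsImaginaryQuadratic K) (ι : K →+* ℂ)
    {N : ℕ} [NeZero N] {W : WeierstrassCurve ℚ} (Dt : ModularParametrizationData W N)
    (hND : IsCoprime (N : ℤ) (NumberField.discr K)) {β : ℤ}
    (hβ : (4 * N : ℤ) ∣ β ^ 2 - NumberField.discr K) {ℓ m n : ℕ} (hℓ : ℓ.Prime)
    (hinert : (Ideal.span {(ℓ : 𝓞 K)}).IsPrime) (hℓN : ¬ ℓ ∣ N) (hℓm : ¬ ℓ ∣ m) (hm : m ≠ 0)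
    (hNm : Nat.Coprime N m) (hunits : 2 ≤ m ∨ NumberField.discr K < -4) (hn : ℓ * m = n)
    {G : Finset (ringClassField K ι n ≃ₐ[ℚ] ringClassField K ι n)}
    (hG : ∀ g, g ∈ G ↔ g ∈ ringClassGalOver ι n m)
    {y : (W.baseChange (ringClassField K ι n)).toAffine.Point}
    (hy : WeierstrassCurve.Affine.Point.map (W' := W)
        (ringClassField K ι n).subtype.toRatAlgHom y =
      heegnerPointComplexOfConductor Dt (NumberField.discr K) β n) :
    WeierstrassCurve.Affine.Point.map (W' := W) (ringClassField K ι n).subtype.toRatAlgHom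
        (∑ g ∈ G, pointGalHom W (ringClassField K ι n) g y) =
      W.LFunction ℓ • heegnerPointComplexOfConductor Dt (NumberField.discr K) β m := by
  subst hn
  exact map_sum_pointGalHom_eq_lFunction_smul hK ι Dt hND hβ hℓ hinert hℓN hℓm hm hNm hunits hG hy

/-! ## §2 The trace relation in `E(K[n])`, `KolyvaginHeegnerData` currency -/

/-- **The powers `σ_ℓ^i`, `i < ℓ + 1`, enumerate `G_ℓ`**: for `ℓ ∥ n` (inert, with the unit
hypothesis at `n / ℓ`) and `σ` with `zpowers σ = G_ℓ = ringClassGalOver ι n (n/ℓ)` (the datum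
`KolyvaginHeegnerData.zpowers_σ`), `g ∈ G_ℓ ↔ g = σ^i` for some `i < ℓ + 1` — as `orderOf σ = ℓ + 1`
(`orderOf_eq_succ_of_zpowers_eq_ringClassGalOver`). [cite: GrossLMS1991, §3 (chunk 217 L1)] -/
theorem mem_image_pow_iff_mem_ringClassGalOver (hK : IsImaginaryQuadratic K) (ι : K →+* ℂ)
    {ℓ n : ℕ} (hℓ : ℓ.Prime) (hinert : (Ideal.span {(ℓ : 𝓞 K)}).IsPrime) (hℓn : ℓ ∣ n)
    (hℓn' : ¬ ℓ ∣ n / ℓ) (hn : n ≠ 0) (hunits : 2 ≤ n / ℓ ∨ NumberField.discr K < -4)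
    {σ : ringClassField K ι n ≃ₐ[ℚ] ringClassField K ι n}
    (hσ : Subgroup.zpowers σ = ringClassGalOver ι n (n / ℓ))
    (g : ringClassField K ι n ≃ₐ[ℚ] ringClassField K ι n) :
    g ∈ (Finset.range (ℓ + 1)).image (fun i : ℕ => σ ^ i) ↔ g ∈ ringClassGalOver ι n (n / ℓ) := by
  have hord : orderOf σ = ℓ + 1 :=
    orderOf_eq_succ_of_zpowers_eq_ringClassGalOver hK ι hℓ hinert hℓn hℓn' hn hunits hσ
  have hfin : IsOfFinOrder σ := orderOf_pos_iff.mp (by omega)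
  rw [← hσ, hfin.mem_zpowers_iff_mem_range_orderOf, hord]

/-- **`i ↦ σ_ℓ^i` is injective on `range (ℓ + 1)`** under the same hypotheses
(`orderOf σ = ℓ + 1`, `pow_injOn_Iio_orderOf`). [cite: GrossLMS1991, §3 (chunk 217 L1)] -/
theorem injOn_pow_range_succ (hK : IsImaginaryQuadratic K) (ι : K →+* ℂ)
    {ℓ n : ℕ} (hℓ : ℓ.Prime) (hinert : (Ideal.span {(ℓ : 𝓞 K)}).IsPrime) (hℓn : ℓ ∣ n)
    (hℓn' : ¬ ℓ ∣ n / ℓ) (hn : n ≠ 0) (hunits : 2 ≤ n / ℓ ∨ NumberField.discr K < -4)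
    {σ : ringClassField K ι n ≃ₐ[ℚ] ringClassField K ι n}
    (hσ : Subgroup.zpowers σ = ringClassGalOver ι n (n / ℓ)) :
    Set.InjOn (fun i : ℕ => σ ^ i) (Finset.range (ℓ + 1) : Finset ℕ) := by
  rw [Finset.coe_range,
    ← orderOf_eq_succ_of_zpowers_eq_ringClassGalOver hK ι hℓ hinert hℓn hℓn' hn hunits hσ]
  exact pow_injOn_Iio_orderOf

/-- **Gross's Prop. 3.7 (1) in `E(K[n])`, `KolyvaginHeegnerData` currency** (statement shape:
x11b3-p8 GEN 7): for `K` imaginary quadratic, `N` prime to `d_K` and to `n`, `ℓ ∈ n.primeFactors`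
inert with `ℓ ∤ N`, `ℓ ∤ n/ℓ`, the unit hypothesis at `n/ℓ`, data `d` at level `n` and `d'` at level
`n/ℓ` (same datum `Dt`, orientation `β`), and `K[n/ℓ] ⊆ K[n]` (`ringClassField_mono`):
`Σ_{i < ℓ+1} (d.σ ℓ)^i • d.y = a_ℓ • (d'.y)↑` in `E(K[n])`, `a_ℓ = W.LFunction ℓ`, `↑` the base
change along `RingClassField.inclusion`.  Proof: `E(K[n]) → E(ℂ)` is injective; there the left side
is `(Σ_{g ∈ G_ℓ} g • y(n))_ℂ` (`injOn_pow_range_succ`, `mem_image_pow_iff_mem_ringClassGalOver`) and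
§1 applies with `d.map_y`, `d'.map_y`. [cite: GrossLMS1991, §3 Prop. 3.7 (1)] -/
theorem sum_pow_pointGalHom_y_eq_lFunction_smul_map (hK : IsImaginaryQuadratic K) (ι : K →+* ℂ)
    {N : ℕ} [NeZero N] {W : WeierstrassCurve ℚ} {Dt : ModularParametrizationData W N}
    (hND : IsCoprime (N : ℤ) (NumberField.discr K)) {β : ℤ} {ℓ n : ℕ}
    (hℓn : ℓ ∈ n.primeFactors) (hinert : (Ideal.span {(ℓ : 𝓞 K)}).IsPrime) (hℓN : ¬ ℓ ∣ N)
    (hℓn' : ¬ ℓ ∣ n / ℓ) (hNn : Nat.Coprime N n) (hunits : 2 ≤ n / ℓ ∨ NumberField.discr K < -4)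
    (d : KolyvaginHeegnerData Dt β ι n) (d' : KolyvaginHeegnerData Dt β ι (n / ℓ))
    (hle : ringClassField K ι (n / ℓ) ≤ ringClassField K ι n) :
    ∑ i ∈ Finset.range (ℓ + 1), pointGalHom W (ringClassField K ι n) (d.σ ℓ ^ i) d.y =
      W.LFunction ℓ • WeierstrassCurve.Affine.Point.map (W' := W)
        ((RingClassField.inclusion ι hle).restrictScalars ℚ) d'.y := by
  obtain ⟨hℓ, hdvd, hn⟩ := Nat.mem_primeFactors.mp hℓn
  have hm : n / ℓ ≠ 0 := by
    intro h
    exact hn (by simpa [h] using (Nat.div_mul_cancel hdvd).symm)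
  have hNm : Nat.Coprime N (n / ℓ) := hNn.coprime_dvd_right (Nat.div_dvd_of_dvd hdvd)
  have hsum : ∑ i ∈ Finset.range (ℓ + 1), pointGalHom W (ringClassField K ι n) (d.σ ℓ ^ i) d.y =
      ∑ g ∈ (Finset.range (ℓ + 1)).image (fun i : ℕ => d.σ ℓ ^ i),
        pointGalHom W (ringClassField K ι n) g d.y :=
    (Finset.sum_image (f := fun g => pointGalHom W (ringClassField K ι n) g d.y)
      (injOn_pow_range_succ hK ι hℓ hinert hdvd hℓn' hn hunits (d.zpowers_σ ℓ hℓn))).symm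
  rw [hsum]
  apply WeierstrassCurve.Affine.Point.map_injective (ringClassField K ι n).subtype.toRatAlgHom
  rw [map_zsmul, map_toRatAlgHom_map_inclusion ι hle (ringClassField K ι n).subtype
    (ringClassField K ι (n / ℓ)).subtype (RingClassField.coe_inclusion ι hle) d'.y, d'.map_y]
  exact map_sum_pointGalHom_eq_lFunction_smul_of_eq hK ι Dt hND d.dvd_sq_sub hℓ hinert hℓN hℓn' hm
    hNm hunits (Nat.mul_div_cancel' hdvd)
    (mem_image_pow_iff_mem_ringClassGalOver hK ι hℓ hinert hdvd hℓn' hn hunits (d.zpowers_σ ℓ hℓn))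
    d.map_y

/-! ## §3 The `h37`-binder spellings -/

/-- **Transfer to the group ring**: for a commutative group `𝒢` acting on `A`, mapped to
`Aut_ℚ(L)` by `ρ` and to `E(L)` by an injective additive `j` with `j (g • a) = ρ g • j a`
(the dictionary `ρ`, `j` of `KolyvaginRingClassInertia.h44_of_prop37_of_totallyRamified`), a relation
`Σ_{i < ℓ+1} (ρ σ)^i • j y = a • j y'` in `E(L)` is Gross's `Tr_ℓ y = a · y'` in `A`:
`grAct A (traceElt σ ℓ) y = a • y'` (`grAct_traceElt`). [cite: GrossLMS1991, §3 (3.5), Prop. 3.7 (1)] -/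
theorem grAct_traceElt_eq_smul_of_pointGalHom {𝒢 : Type*} [CommGroup 𝒢] {A : Type*}
    [AddCommGroup A] [DistribMulAction 𝒢 A] {L : Type*} [Field L] [CharZero L]
    {W : WeierstrassCurve ℚ} (ρ : 𝒢 →* (L ≃ₐ[ℚ] L)) (j : A →+ (W.baseChange L).toAffine.Point)
    (hj : Function.Injective j) (hρj : ∀ (g : 𝒢) (a : A), j (g • a) = pointGalHom W L (ρ g) (j a))
    {σ : 𝒢} {ℓ : ℕ} {a : ℤ} {y y' : A}
    (h : ∑ i ∈ Finset.range (ℓ + 1), pointGalHom W L (ρ σ ^ i) (j y) = a • j y') :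
    grAct A (traceElt σ ℓ) y = a • y' := by
  apply hj
  rw [grAct_traceElt, map_sum, map_zsmul, ← h]
  refine Finset.sum_congr rfl fun i _ => ?_
  rw [hρj, map_pow]

/-- **`a_ℓ = a_ℓ`**: the tree's two currencies for the `ℓ`-th coefficient agree at a good prime of a
global minimal model — `W.LFunction ℓ` (Mathlib's Euler product, the currency of
`lFunction_zsmul_φ_of_not_dvd`) and `W.frobeniusTrace ℓ = ℓ + 1 − #Ẽ(𝔽_ℓ)` (the currency of the `h37`
binder) — so any relation `a_ℓ • P = Q` transfers (`LFunction_apply_prime_eq_frobeniusTrace`).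
[cite: SilvermanAEC2009, Exercise 8.19(a) (p. 230) and §C.16] -/
theorem frobeniusTrace_smul_eq_of_lFunction_smul_eq {W : WeierstrassCurve ℚ} [W.IsElliptic]
    [W.IsGloballyMinimal] {ℓ : ℕ} [Fact ℓ.Prime] (hgood : W.HasGoodReductionAtPrime ℓ)
    {M : Type*} [AddCommGroup M] {P Q : M} (h : Q = W.LFunction ℓ • P) :
    Q = W.frobeniusTrace ℓ • P := by
  rw [h, WeierstrassCurve.LFunction_apply_prime_eq_frobeniusTrace W ℓ hgood]

end Summit.BirchSwinnertonDyer.Rank1Residual.X11b.HeegnerTrace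

end
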